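import Literature.MathematicalPhysics.QuantumFieldTheory.Balaban1983to89.B8Prop6CubeMemberScalarGammaHoldsSU
import Summits.QuantumFields.YangMills.Theorems.UnitScaleTiltHalvingP6JCoveringMember
import HarnessLib

/-!
# Route `UnitScaleTilt`, crux K1 child «MinimiserStabilityRegPr» (stmt-QuantumFields-19200), registered stub `stub_halvingStep` (v10 `BirthV10`) —
# ★★ LINE «H-P6J», FILE (J1-SU2): [Balaban1985RegularSpaces] PROPOSITION 6 AT THE H LANE's CUBE MEMBER WITH A **SPECIAL-UNITARY** GAUGE TRANSFORMATION —
# the `G = SU(2)` editions of ✓`HalvingP6JGaugedBoundAtMember.gaugedBoundB8_member_univ` (p678606) and ✓`HalvingP6JCoveringMember.gaugedBoundB8_member_cover` (p679474),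
# BY NAME from pub-ymgap's `G`-crown `B8Prop6CubeMemberScalarGammaHoldsSU.gaugedBoundB8_cubeMember_scalar_γ_holds_L3_specialUnitary` (obstacle (O1) of LOCATE-PROP6-JUNCTION RETIRED)

Cell `ym3-torus` (HUMAN RULING D-0037: YM₃ on T³ is ladder rung R3 — NOT d = 4, NOT a mass gap, NOT the Clay problem), width seat `ym-ust-19200-w7` gen 7 (row (J1-SU2) of line
H-P6J; w7 g6 FINAL «open rows handed back» (a); LOCATE-PROP6-JUNCTION 5b0d193f §4 (O1)).  `--supports stmt-QuantumFields-19200 --as helper`; THEOREMS ONLY (0 `def`, 0 `sorry`,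
0 `instance` — the `CStarAlgebra (Matrix (Fin 2) (Fin 2) ℂ)` structure is a `letI` inside statement and proof, exactly as in lit `B8Prop6CubeMemberScalarGammaHoldsSU`);
count-neutral; nothing here claims `hSupUρ4`, the stub, the crux or the gap.

WHY.  The H lane's per-site rows need the chart gauge `u₁` to be `SU(2)`-VALUED (`hu₁SU` of ✓`HalvingHSupURho4OfSiteRows.hSupUρ4_of_siteRows`'s 22-row body: the knit back to the
torus field `U : SU(2)` goes through `suIncl`) — obstacle (O1) of the P6J junction: lit's unitary crown (✓p678606's input) returns `u ∈ U(2)` only.  pub-ymgap dag-n05-e g33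
(cross-cell service XCELL-2, 2026-08-29) re-ran [B8] Prop. 6's γ-crown for a subgroup `G ≤ U(𝔸)` carrying the joint J-SU data and INHABITED it at `𝔸 = M_N(ℂ)`, `G = SU(N)`
(`N ≤ 25`), `H = SL(N, ℂ)`, `τ = tr` — lit ★★★`gaugedBoundB8_cubeMember_scalar_γ_holds_L3_specialUnitary (hd2) (hL3) (hodd) (hN : N ≤ 25)`: for `SU(N)`-valued `U₀ ∈ 𝔄_K(α₀)`
the gauge transformation `u` of (1.135)–(1.138) AND `v⁻¹u` are `SU(N)`-valued.  THIS FILE reads it at `N = 2` in the H lane's member letters: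
* §1 ★★ `gaugedBoundB8_member_univ_su2` — ✓p678606 §2's quantifier prefix VERBATIM (ambient `Ω := univ`, top level `k`, datum `(a, M′, ρ′)` under `CubeB8`'s four scalar laws,
  print's p.98 side conditions on `(M′, ρ′)` displayed; `5 ≤ d·L` dropped — the `L ≥ 3` crown no longer asks it) with `U′` now `SU(2)`-valued, and the CONCLUSION = `Node00.GaugedBoundB8`'s
  ∃`u`-body (lit `Node00/CarriersB8Cube` :142–:157) SPELLED OUT IN THE MEMBER's RAW LETTERS (`cubeFam false L a M′ ρ′ k`, `cubeLamS L a M′ ρ′ k k`, `cutFixed`, `localGauge`, `ctr`,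
  `mlogCfg` — the carrier's `c.sq ∕ c.lamS ∕ c.fixed ∕ c.vfix ∕ c.expo ∕ c.axial` unfolded, all `abbrev`s, `rfl`) with `u x ∈ specialUnitaryUnits (Fin 2)` at conjuncts 1 and 6.
* §2 ★★ `gaugedBoundB8_member_cover_su2` — ✓p679474's covering member (`exists_coveringCubeB8`: admissible `(M″, ρ″)` affine in `ρ′`, divisibility discharged, cubes monotone)
  with the same `SU(2)` body at `(a, M″, ρ″)` and the affine number `r = 7dL²·(5dLB₀)·(M′ + ρ′ + 11d + 2L^{s+1})·α₀` (the body is monotone in `r`: conjuncts 5, 8, 9, 10).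
USE ((J2)∕(J2′) consumer, inside a proof with `letI : CStarAlgebra (Matrix (Fin 2) (Fin 2) ℂ) := {}` in force):
`obtain ⟨B₀, c₁, ρ₀, M₀, N₀, R₀, hB₀, hc₁, hGB⟩ := gaugedBoundB8_member_univ_su2 hd2 hL3 hodd` once per `L`, then per member
`obtain ⟨u, huSU, huS, h129, h138, h136, hwSU, h135, hgrad, hdiv, hLap, h137⟩ := hGB η hη a hk hLρ hρM hbig hLdM s R h3 hM₀ hdρ hdM hRρ h2R hR₀ hN₀ hρ₀ U′ hU′SU α₀ hα₀ hInAk hwin`.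
HONEST SCOPE.  By-name instantiation of ONE landed lit theorem (+ ✓p679474's elementary covering datum); nothing of Prop. 6 is re-proved; the p.98 side conditions and `CubeB8`'s laws stay
HYPOTHESES; nothing of the stub, the crux, the rung or the gap.

References: T. Bałaban, CMP **99** (1985) 75–102 [Balaban1985RegularSpaces] (Prop. 6 (1.135)–(1.138) p.99, p.98 (the cube datum), (1.131) p.99, p.76 «we consider … G = SU(N)»);
CMP **98** (1985) 17–51 [Balaban1985Averaging] (p.20, (42)–(43) pp.23–24: `SU(N)` is averaging-closed); CMP **99** (1985) 389–434 [Balaban1985BackgroundPropagators] (Thms 3.1–3.3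
pp.397–399 — discharged inside lit's crown at the flat gauge-fixing background).
-/

set_option autoImplicit false

noncomputable section

open NormedSpace

namespace Summit.QuantumFields.YangMills.Theorems.HalvingP6JGaugedBoundAtMemberSU2

open Literature.MathematicalPhysics.QuantumFieldTheory.Balaban1983to89
open B7Prop1Explicit B7Prop2Explicit B7Prop1Local
open MatrixLog (mlog)
open B7Prop2SpecialUnitary (specialUnitaryUnits)
open B8LeafModelZd3 (mlogCfg)
open B8Ineq130 (tlo thi)
open B8Ineq132 (InAk covDerivFwd)
open B8Ineq133 (cutFixed)
open B8Eq115GaugeFixing (localGauge)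
open B8Eq119TwistedAxial (Restr129)
open B8Eq184Proof (cfgExp)
open B8Eq140Level (SideTouches)
open B8Eq138LandauZd (IsLandau138W logCfg covLap)
open B8Eq146AExpansion (iEta plaqCovDeriv)
open B8Eq143PlaqExpansion (pdiv)
open B7Prop4GeneralLevels (logCovIter)
open B8ScaledSupNorm (bondNorm msup)
open B8Eq131Cubes (box tcube tLo tHi ctr bLo bHi cube)
open B8Eq131CubesAdmissible (cubeFam)
open B8CubeMemberZd (cubeLamS)
open Node00 (CubeB8)
open B8Prop6CubeMemberScalarGammaHoldsSU (gaugedBoundB8_cubeMember_scalar_γ_holds_L3_specialUnitary)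
open HalvingP6JCoveringMember (exists_coveringCubeB8)

open scoped Matrix.Norms.L2Operator

variable {d : ℕ}

/-! ## §1 The H-lane member form, `SU(2)`-valued gauge: ambient domains `univ`, cube datum `⟨k, a, M′, ρ′⟩` -/

/-- ★★ **PROPOSITION 6 AT THE H LANE's MEMBER WITH A SPECIAL-UNITARY GAUGE TRANSFORMATION** (ambient `Ω := univ`, top level `k`, datum `(a, M′, ρ′)` under `CubeB8`'s four
laws DISPLAYED): for odd `L ≥ 3`, `2 ≤ d` there are L-only `B₀ ≥ 1`, `c₁ > 0`, `ρ₀ M₀ N₀ R₀` such that every `SU(2)`-valued `U′` with `InAk L k η α₀ univ U′` (J3's (1.34)-𝔄 row)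
and `7dL²·M′·α₀ ≤ c₁` has Prop. 6's Landau gauge `u` on the cube member `{cubeFam false L a M′ ρ′ k}` with `u` AND `v⁻¹u` (`v = localGauge …`, p.98's axial gauge) `SU(2)`-VALUED,
`u = 1` off `□₀`, (1.29), (1.38) at background `1` for `U₁ = U₀″^{u⁻¹}`, (1.136)₁ with Hermitian logarithm, `U′^{(v⁻¹u)⁻¹} = U₁` on `□̃`, (1.136)₂–₄, (1.137) — number
`r = 7dL²·(5dLB₀)·M′·α₀` — under print's p.98 side conditions on `(M′, ρ′)`.  The carrier's abbreviations unfolded (`rfl`).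
[cite: Balaban1985RegularSpaces, Prop. 6 (1.135)–(1.138) p.99, p.98, (1.34) p.82, p.76; Balaban1985Averaging, p.20, (42)–(43) pp.23–24; Balaban1985BackgroundPropagators, Thm 3.3 p.399] -/
theorem gaugedBoundB8_member_univ_su2 (hd2 : 2 ≤ d) {L : ℕ} (hL3 : 3 ≤ L) (hodd : Odd L) :
    letI : CStarAlgebra (Matrix (Fin 2) (Fin 2) ℂ) := {}
    ∃ B₀ c₁ ρ₀ M₀ : ℝ, ∃ N₀ R₀ : ℕ, 1 ≤ B₀ ∧ 0 < c₁ ∧ ∀ (η : ℝ), 0 < η →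
      ∀ (a : Site d) {k M' ρ' : ℕ} (_hk : 1 ≤ k) (_hLρ : L ≤ ρ') (_hρM : ρ' ≤ M') (_hbig : 11 * d < M') (_hLdM : L ≤ d * M'),
      ∀ (s R : ℕ), 3 ≤ L ^ s → M₀ ≤ (L : ℝ) ^ (s + 1) → L ^ (s + 1) ∣ ρ' → L ^ (s + 1) ∣ M' → R * L ^ (s + 1) ≤ ρ' → 2 * L ≤ R →
        R₀ ≤ R → N₀ + 1 ≤ R * L ^ (s + 1) → ρ₀ ≤ (ρ' : ℝ) →
      ∀ (U' : Site d → Fin d → (Matrix (Fin 2) (Fin 2) ℂ)ˣ), (∀ x κ, U' x κ ∈ specialUnitaryUnits (Fin 2)) → ∀ (α₀ : ℝ), 0 < α₀ →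
        InAk L k η α₀ (fun _ => (Set.univ : Set (Site d))) U' →
        7 * d * (L : ℝ) ^ 2 * M' * α₀ ≤ c₁ →
      ∃ u : Site d → (Matrix (Fin 2) (Fin 2) ℂ)ˣ, (∀ x, u x ∈ specialUnitaryUnits (Fin 2)) ∧ (∀ x, x ∉ cubeFam false L a M' ρ' k 0 → u x = 1) ∧
        Restr129 L k (cubeLamS L a M' ρ' k k) (1 : Site d → Fin d → (Matrix (Fin 2) (Fin 2) ℂ)ˣ) u ∧
        IsLandau138W L k η (cubeFam false L a M' ρ' k 0) (cubeLamS L a M' ρ' k k) (1 : Site d → Fin d → (Matrix (Fin 2) (Fin 2) ℂ)ˣ)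
          (gaugeAct u⁻¹ (cutFixed L (tLo a ρ') (tHi a M' ρ') U' k (ctr a M'))) ∧
        (∀ j, j ≤ k → ∀ b ∈ {b : Site d × Fin d | SideTouches (cubeFam false L a M' ρ' k j) b.1 b.2},
          gaugeAct u⁻¹ (cutFixed L (tLo a ρ') (tHi a M' ρ') U' k (ctr a M')) b.1 b.2
              = cfgExp η (logCfg η (gaugeAct u⁻¹ (cutFixed L (tLo a ρ') (tHi a M' ρ') U' k (ctr a M')))) b.1 b.2 ∧
            IsSelfAdjoint (logCfg η (gaugeAct u⁻¹ (cutFixed L (tLo a ρ') (tHi a M' ρ') U' k (ctr a M'))) b.1 b.2) ∧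
            ‖logCfg η (gaugeAct u⁻¹ (cutFixed L (tLo a ρ') (tHi a M' ρ') U' k (ctr a M'))) b.1 b.2‖
              ≤ (7 * d * (L : ℝ) ^ 2 * (5 * (d : ℝ) * L * B₀) * M' * α₀) * ((L : ℝ) ^ j * η)⁻¹) ∧
        (∀ x, ((localGauge L (tLo a ρ') (tHi a M' ρ') U' k (ctr a M'))⁻¹ * u) x ∈ specialUnitaryUnits (Fin 2)) ∧
        AgreeOn (tlo L (tLo a ρ') k) (thi L (tHi a M' ρ') k)
          (gaugeAct ((localGauge L (tLo a ρ') (tHi a M' ρ') U' k (ctr a M'))⁻¹ * u)⁻¹ U')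
          (gaugeAct u⁻¹ (cutFixed L (tLo a ρ') (tHi a M' ρ') U' k (ctr a M'))) ∧
        msup L k η (-(2 : ℝ)) (fun j (t : Fin d × Fin d × Site d) => SideTouches (cubeFam false L a M' ρ' k j) t.2.2 t.2.1)
            (fun t => covDerivFwd η (1 : Site d → Fin d → (Matrix (Fin 2) (Fin 2) ℂ)ˣ) t.1
              (fun z => mlogCfg k η (cubeFam false L a M' ρ' k) (gaugeAct u⁻¹ (cutFixed L (tLo a ρ') (tHi a M' ρ') U' k (ctr a M'))) z t.2.1) t.2.2)
          ≤ 7 * d * (L : ℝ) ^ 2 * (5 * (d : ℝ) * L * B₀) * M' * α₀ ∧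
        bondNorm L k η (-(3 : ℝ)) (cubeFam false L a M' ρ' k)
            (fun x μ => pdiv η (1 : Site d → Fin d → (Matrix (Fin 2) (Fin 2) ℂ)ˣ)
              (plaqCovDeriv η (1 : Site d → Fin d → (Matrix (Fin 2) (Fin 2) ℂ)ˣ)
                (mlogCfg k η (cubeFam false L a M' ρ' k) (gaugeAct u⁻¹ (cutFixed L (tLo a ρ') (tHi a M' ρ') U' k (ctr a M'))))) μ x)
          ≤ 7 * d * (L : ℝ) ^ 2 * (5 * (d : ℝ) * L * B₀) * M' * α₀ ∧
        bondNorm L k η (-(3 : ℝ)) (cubeFam false L a M' ρ' k)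
            (fun x μ => covLap η (1 : Site d → Fin d → (Matrix (Fin 2) (Fin 2) ℂ)ˣ)
              (fun z => mlogCfg k η (cubeFam false L a M' ρ' k) (gaugeAct u⁻¹ (cutFixed L (tLo a ρ') (tHi a M' ρ') U' k (ctr a M'))) z μ) x)
          ≤ 7 * d * (L : ℝ) ^ 2 * (5 * (d : ℝ) * L * B₀) * M' * α₀ ∧
        (∀ (x : Site d) (μ : Fin d), bLo L a 0 0 ≤ x → x + e μ ≤ bHi L a M' 0 0 →
          logCovIter L (1 : Site d → Fin d → (Matrix (Fin 2) (Fin 2) ℂ)ˣ)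
              (iEta η (mlogCfg k η (cubeFam false L a M' ρ' k) (gaugeAct u⁻¹ (cutFixed L (tLo a ρ') (tHi a M' ρ') U' k (ctr a M'))))) k x μ
            = mlog ((avgIter L (gaugeAct (localGauge L (tLo a ρ') (tHi a M' ρ') U' k (ctr a M')) U') k x μ : (Matrix (Fin 2) (Fin 2) ℂ)ˣ) :
                Matrix (Fin 2) (Fin 2) ℂ)) := by
  letI : CStarAlgebra (Matrix (Fin 2) (Fin 2) ℂ) := {}
  obtain ⟨B₀, c₁, ρ₀, M₀, N₀, R₀, hB₀, hc₁, h⟩ :=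
    gaugedBoundB8_cubeMember_scalar_γ_holds_L3_specialUnitary (d := d) hd2 hL3 hodd (N := 2) (by norm_num)
  refine ⟨B₀, c₁, ρ₀, M₀, N₀, R₀, hB₀, hc₁, ?_⟩
  intro η hη a k M' ρ' hk hLρ hρM hbig hLdM s R h3 hM₀ hdρ hdM hRρ h2R hR₀ hN₀ hρ₀ U' hU' α₀ hα₀ hInAk hwin
  exact h η hη
    ({ k := k, a := a, M := M', ρ := ρ', one_le_k := hk, k_le := le_rfl, L_le_ρ := hLρ, ρ_le_M := hρM, big := hbig, L_le_dM := hLdM,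
       box_sub := Set.subset_univ _, tcube_sub := Set.subset_univ _ } :
      CubeB8 d L k (fun _ => (Set.univ : Set (Site d))))
    s R h3 hM₀ hdρ hdM hRρ h2R hR₀ hN₀ hρ₀ U' hU' α₀ hα₀ hInAk hwin

/-! ## §2 The covering cube member (obstacle (O2)), `SU(2)`-valued gauge, divisibility discharged -/

/-- ★★ **PROPOSITION 6 WITH A SPECIAL-UNITARY GAUGE AT THE COVERING CUBE MEMBER, p.98's DIVISIBILITY CONDITIONS DISCHARGED** (LINE H-P6J (J1b), `SU(2)` edition of
✓`HalvingP6JCoveringMember.gaugedBoundB8_member_cover`): for `2 ≤ d`, `3 ≤ L` odd there are `1 ≤ B₀`, `0 < c₁`, `ρ₀, M₀, N₀, R₀` such that for every corner `a`, `1 ≤ k`, collar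
`ρ′ ≥ L`, side `M′` and `s` there is a covering member `(a, M″, ρ″)` (✓`exists_coveringCubeB8`: `ρ′ ≤ ρ″ ≤ ρ′ + L^{s+1}`, `M′ ≤ M″ ≤ M′ + ρ′ + 11d + 2L^{s+1}`, `L^{s+1} ∣ ρ″, M″`,
`□″_j ⊇ □_j`, `□̃″ ⊇ □̃`, `□″ ⊇ □`) at which — for every spacing `η > 0`, every `R` with the remaining p.98 conditions READ AT `ρ′`, every `SU(2)`-valued `U′ ∈ 𝔄_k({ℤᵈ}, α₀)` in the
AFFINE window `7dL²·(M′ + ρ′ + 11d + 2L^{s+1})·α₀ ≤ c₁` — §1's `SU(2)` body holds at `(a, M″, ρ″)` with the affine number `r = 7dL²·(5dLB₀)·(M′ + ρ′ + 11d + 2L^{s+1})·α₀`.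
Proof: §1 at the covering member; the body is monotone in `r` (conjuncts 5, 8, 9, 10). [cite: Balaban1985RegularSpaces, Prop. 6 (1.135)–(1.138) p.99, p.98, p.76] -/
theorem gaugedBoundB8_member_cover_su2 (hd2 : 2 ≤ d) {L : ℕ} (hL3 : 3 ≤ L) (hodd : Odd L) :
    letI : CStarAlgebra (Matrix (Fin 2) (Fin 2) ℂ) := {}
    ∃ B₀ c₁ ρ₀ M₀ : ℝ, ∃ N₀ R₀ : ℕ, 1 ≤ B₀ ∧ 0 < c₁ ∧
      ∀ (a : Site d) {k ρ' : ℕ} (M' : ℕ) (_hk : 1 ≤ k) (_hLρ : L ≤ ρ') (s : ℕ),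
      ∃ (ρ'' M'' : ℕ), L ≤ ρ'' ∧ ρ'' ≤ M'' ∧ 11 * d < M'' ∧ L ≤ d * M'' ∧
        ρ' ≤ ρ'' ∧ ρ'' ≤ ρ' + L ^ (s + 1) ∧ M' ≤ M'' ∧ M'' ≤ M' + ρ' + 11 * d + 2 * L ^ (s + 1) ∧
        L ^ (s + 1) ∣ ρ'' ∧ L ^ (s + 1) ∣ M'' ∧
        (∀ j, cube L a M' ρ' k j ⊆ cube L a M'' ρ'' k j) ∧ (∀ j, cubeFam false L a M' ρ' k j ⊆ cubeFam false L a M'' ρ'' k j) ∧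
        tcube L a M' ρ' k ⊆ tcube L a M'' ρ'' k ∧ box L a M' k ⊆ box L a M'' k ∧
        ∀ (η : ℝ), 0 < η → ∀ (R : ℕ), 3 ≤ L ^ s → M₀ ≤ (L : ℝ) ^ (s + 1) → R * L ^ (s + 1) ≤ ρ' → 2 * L ≤ R →
          R₀ ≤ R → N₀ + 1 ≤ R * L ^ (s + 1) → ρ₀ ≤ (ρ' : ℝ) →
        ∀ (U' : Site d → Fin d → (Matrix (Fin 2) (Fin 2) ℂ)ˣ), (∀ x κ, U' x κ ∈ specialUnitaryUnits (Fin 2)) → ∀ (α₀ : ℝ), 0 < α₀ →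
          InAk L k η α₀ (fun _ => (Set.univ : Set (Site d))) U' →
          7 * d * (L : ℝ) ^ 2 * ((M' + ρ' + 11 * d + 2 * L ^ (s + 1) : ℕ) : ℝ) * α₀ ≤ c₁ →
      ∃ u : Site d → (Matrix (Fin 2) (Fin 2) ℂ)ˣ, (∀ x, u x ∈ specialUnitaryUnits (Fin 2)) ∧ (∀ x, x ∉ cubeFam false L a M'' ρ'' k 0 → u x = 1) ∧
        Restr129 L k (cubeLamS L a M'' ρ'' k k) (1 : Site d → Fin d → (Matrix (Fin 2) (Fin 2) ℂ)ˣ) u ∧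
        IsLandau138W L k η (cubeFam false L a M'' ρ'' k 0) (cubeLamS L a M'' ρ'' k k) (1 : Site d → Fin d → (Matrix (Fin 2) (Fin 2) ℂ)ˣ)
          (gaugeAct u⁻¹ (cutFixed L (tLo a ρ'') (tHi a M'' ρ'') U' k (ctr a M''))) ∧
        (∀ j, j ≤ k → ∀ b ∈ {b : Site d × Fin d | SideTouches (cubeFam false L a M'' ρ'' k j) b.1 b.2},
          gaugeAct u⁻¹ (cutFixed L (tLo a ρ'') (tHi a M'' ρ'') U' k (ctr a M'')) b.1 b.2
              = cfgExp η (logCfg η (gaugeAct u⁻¹ (cutFixed L (tLo a ρ'') (tHi a M'' ρ'') U' k (ctr a M'')))) b.1 b.2 ∧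
            IsSelfAdjoint (logCfg η (gaugeAct u⁻¹ (cutFixed L (tLo a ρ'') (tHi a M'' ρ'') U' k (ctr a M''))) b.1 b.2) ∧
            ‖logCfg η (gaugeAct u⁻¹ (cutFixed L (tLo a ρ'') (tHi a M'' ρ'') U' k (ctr a M''))) b.1 b.2‖
              ≤ (7 * d * (L : ℝ) ^ 2 * (5 * (d : ℝ) * L * B₀) * ((M' + ρ' + 11 * d + 2 * L ^ (s + 1) : ℕ) : ℝ) * α₀) * ((L : ℝ) ^ j * η)⁻¹) ∧
        (∀ x, ((localGauge L (tLo a ρ'') (tHi a M'' ρ'') U' k (ctr a M''))⁻¹ * u) x ∈ specialUnitaryUnits (Fin 2)) ∧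
        AgreeOn (tlo L (tLo a ρ'') k) (thi L (tHi a M'' ρ'') k)
          (gaugeAct ((localGauge L (tLo a ρ'') (tHi a M'' ρ'') U' k (ctr a M''))⁻¹ * u)⁻¹ U')
          (gaugeAct u⁻¹ (cutFixed L (tLo a ρ'') (tHi a M'' ρ'') U' k (ctr a M''))) ∧
        msup L k η (-(2 : ℝ)) (fun j (t : Fin d × Fin d × Site d) => SideTouches (cubeFam false L a M'' ρ'' k j) t.2.2 t.2.1)
            (fun t => covDerivFwd η (1 : Site d → Fin d → (Matrix (Fin 2) (Fin 2) ℂ)ˣ) t.1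
              (fun z => mlogCfg k η (cubeFam false L a M'' ρ'' k) (gaugeAct u⁻¹ (cutFixed L (tLo a ρ'') (tHi a M'' ρ'') U' k (ctr a M''))) z t.2.1) t.2.2)
          ≤ 7 * d * (L : ℝ) ^ 2 * (5 * (d : ℝ) * L * B₀) * ((M' + ρ' + 11 * d + 2 * L ^ (s + 1) : ℕ) : ℝ) * α₀ ∧
        bondNorm L k η (-(3 : ℝ)) (cubeFam false L a M'' ρ'' k)
            (fun x μ => pdiv η (1 : Site d → Fin d → (Matrix (Fin 2) (Fin 2) ℂ)ˣ)
              (plaqCovDeriv η (1 : Site d → Fin d → (Matrix (Fin 2) (Fin 2) ℂ)ˣ)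
                (mlogCfg k η (cubeFam false L a M'' ρ'' k) (gaugeAct u⁻¹ (cutFixed L (tLo a ρ'') (tHi a M'' ρ'') U' k (ctr a M''))))) μ x)
          ≤ 7 * d * (L : ℝ) ^ 2 * (5 * (d : ℝ) * L * B₀) * ((M' + ρ' + 11 * d + 2 * L ^ (s + 1) : ℕ) : ℝ) * α₀ ∧
        bondNorm L k η (-(3 : ℝ)) (cubeFam false L a M'' ρ'' k)
            (fun x μ => covLap η (1 : Site d → Fin d → (Matrix (Fin 2) (Fin 2) ℂ)ˣ)
              (fun z => mlogCfg k η (cubeFam false L a M'' ρ'' k) (gaugeAct u⁻¹ (cutFixed L (tLo a ρ'') (tHi a M'' ρ'') U' k (ctr a M''))) z μ) x)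
          ≤ 7 * d * (L : ℝ) ^ 2 * (5 * (d : ℝ) * L * B₀) * ((M' + ρ' + 11 * d + 2 * L ^ (s + 1) : ℕ) : ℝ) * α₀ ∧
        (∀ (x : Site d) (μ : Fin d), bLo L a 0 0 ≤ x → x + e μ ≤ bHi L a M'' 0 0 →
          logCovIter L (1 : Site d → Fin d → (Matrix (Fin 2) (Fin 2) ℂ)ˣ)
              (iEta η (mlogCfg k η (cubeFam false L a M'' ρ'' k) (gaugeAct u⁻¹ (cutFixed L (tLo a ρ'') (tHi a M'' ρ'') U' k (ctr a M''))))) k x μ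
            = mlog ((avgIter L (gaugeAct (localGauge L (tLo a ρ'') (tHi a M'' ρ'') U' k (ctr a M'')) U') k x μ : (Matrix (Fin 2) (Fin 2) ℂ)ˣ) :
                Matrix (Fin 2) (Fin 2) ℂ)) := by
  letI : CStarAlgebra (Matrix (Fin 2) (Fin 2) ℂ) := {}
  obtain ⟨B₀, c₁, ρ₀, M₀, N₀, R₀, hB₀, hc₁, h⟩ := gaugedBoundB8_member_univ_su2 (d := d) hd2 hL3 hodd
  refine ⟨B₀, c₁, ρ₀, M₀, N₀, R₀, hB₀, hc₁, ?_⟩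
  intro a k ρ' M' hk hLρ s
  obtain ⟨ρ'', M'', h1, h2, h3, h4, h5, h6, h7, h8, h9, h10, hc, hcf, ht, hb⟩ :=
    exists_coveringCubeB8 (d := d) (by omega) (by omega) a M' hLρ k s
  refine ⟨ρ'', M'', h7, h8, h9, h10, h1, h2, h3, h4, h5, h6, hc, hcf, ht, hb, ?_⟩
  intro η hη R h3s hM₀ hRρ h2R hR₀ hN₀ hρ₀ U' hU' α₀ hα₀ hInAk hwin
  have hB₀0 : 0 ≤ B₀ := by linarith
  have hcast : (M'' : ℝ) ≤ ((M' + ρ' + 11 * d + 2 * L ^ (s + 1) : ℕ) : ℝ) := by exact_mod_cast h4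
  have hρcast : (ρ' : ℝ) ≤ ρ'' := by exact_mod_cast h1
  have hwin'' : 7 * d * (L : ℝ) ^ 2 * M'' * α₀ ≤ c₁ :=
    le_trans (mul_le_mul_of_nonneg_right (mul_le_mul_of_nonneg_left hcast (by positivity)) hα₀.le) hwin
  have hr : 7 * d * (L : ℝ) ^ 2 * (5 * (d : ℝ) * L * B₀) * M'' * α₀
      ≤ 7 * d * (L : ℝ) ^ 2 * (5 * (d : ℝ) * L * B₀) * ((M' + ρ' + 11 * d + 2 * L ^ (s + 1) : ℕ) : ℝ) * α₀ :=
    mul_le_mul_of_nonneg_right (mul_le_mul_of_nonneg_left hcast (by positivity)) hα₀.le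
  obtain ⟨u, huSU, huS, h129, h138, h136, hwSU, h135, hgrad, hdiv, hLap, h137⟩ :=
    h η hη a hk h7 h8 h9 h10 s R h3s hM₀ h5 h6 (hRρ.trans h1) h2R hR₀ hN₀ (hρ₀.trans hρcast) U' hU' α₀ hα₀ hInAk hwin''
  refine ⟨u, huSU, huS, h129, h138, ?_, hwSU, h135, hgrad.trans hr, hdiv.trans hr, hLap.trans hr, h137⟩
  intro j hj b hb
  obtain ⟨hb1, hb2, hb3⟩ := h136 j hj b hb
  exact ⟨hb1, hb2, hb3.trans (mul_le_mul_of_nonneg_right hr (inv_nonneg.mpr (by positivity)))⟩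

end Summit.QuantumFields.YangMills.Theorems.HalvingP6JGaugedBoundAtMemberSU2

end
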